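import Literature.Probability.RandomPlanarGeometry.BrownianExitPathLaw
import Literature.Probability.Process.BrownianPair
import Mathlib.Probability.Distributions.Gaussian.IsGaussianProcess.Independence
import Mathlib.Topology.Algebra.Module.FiniteDimension
import HarnessLib

/-!
# Rotation invariance of the planar Wiener law (the 45° rotation with time doubling)

Topic `Literature/Probability/RandomPlanarGeometry` (next to `BrownianExitPathLaw`, whose Wiener
law `wienerLawC` on `C([0, ∞), ℝ)` it concerns); theorems only; no definition and no named fact.

For two independent Wiener paths `(p¹, p²)` (law `wienerLawC ⊗ wienerLawC` on
`C([0,∞), ℝ) × C([0,∞), ℝ)`), the pair of paths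

  `U(t) = (p¹(2t) + p²(2t))/2`,  `V(t) = (p¹(2t) - p²(2t))/2`

is again a pair of independent Wiener paths (`map_rotate_eq_prod_wienerLawC`,
`measurePreserving_rotate`). Equivalently: `W(t) = ((p¹ + p²)/2, (p¹ - p²)/2)(t)`, the planar
Brownian motion of the rotation coupling of `PlanarSkorokhodCoupling`, satisfies
"`t ↦ W(2t)` is a standard planar Brownian motion" — the normalisation `B(t) ≈ S(2t)` of
Lawler (1996), Lemma 3.1. This is the rotation invariance of planar Brownian motion (by the
angle `π/4`, combined with Brownian scaling by the factor `2`), noted as not yet available in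
`BrownianLoopMeasureSimilarity`.

Proof: the coordinate processes `X¹_t = p¹(t)`, `X²_t = p²(t)` are independent pre-Brownian
motions, hence JOINTLY Gaussian (`isGaussianProcess_sumElim_coord`, from Mathlib's
`IndepFun.hasGaussianLaw` on finite-dimensional marginals); `U, V` are linear combinations, hence
jointly Gaussian, centred, with `Cov(U_s, U_t) = Cov(V_s, V_t) = s ∧ t` and `Cov(U_s, V_t) = 0`;
so `U` and `V` are pre-Brownian (`IsGaussianProcess.isPreBrownianReal_of_covariance`) and
independent (`IsGaussianProcess.indepFun_of_covariance_eq_zero`), and their path laws are the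
Wiener law (`identDistrib_toPathC`, `IsPreBrownianReal.map_path_eq`).

## References

* G. F. Lawler, *Cut times for simple random walk*, Electron. J. Probab. **1** (1996), no. 13,
  §3 (normalisation `B(t)` vs `S(td)`). [Lawler1996CutTimes]
* J.-F. Le Gall, *Brownian Motion, Martingales, and Stochastic Calculus* (2016), Prop. 2.5 and
  Exercise 2.26 (invariance of planar Brownian motion under isometries). [Legall2016]
-/

noncomputable section

open MeasureTheory ProbabilityTheory Filter Set
open scoped NNReal ENNReal Topology

namespace Literature.Probability.RandomPlanarGeometry

open Literature.Probability.Process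

section Rotation

variable [MeasurableSpace C(ℝ≥0, ℝ)] [BorelSpace C(ℝ≥0, ℝ)]

/-! ### The coordinate process under the Wiener law is pre-Brownian -/

/-- **The coordinate process is a pre-Brownian motion under the Wiener law** (its finite
dimensional laws are those of the canonical Brownian motion, of which `wienerLawC` is the path
law). [folklore] -/
theorem isPreBrownianReal_coordProcess : IsPreBrownianReal coordProcess (wienerLawC) := by
  refine ⟨fun I ↦ ⟨?_, ?_⟩⟩
  · exact (measurable_pi_lambda _ fun i ↦ measurable_coordProcess _).aemeasurable
  · have h := (isPreBrownianReal_brownian.hasLaw I).map_eq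
    have hm : Measurable fun (p : C(ℝ≥0, ℝ)) ↦ I.restrict (coordProcess · p) :=
      measurable_pi_lambda _ fun i ↦ measurable_coordProcess _
    rw [wienerLawC, Measure.map_map hm measurable_brownianPathC]
    exact h

/-- The first coordinate path process `(t, (p¹, p²)) ↦ p¹(t)` is pre-Brownian under the product
Wiener law. [folklore] -/
theorem isPreBrownianReal_fst :
    IsPreBrownianReal (fun t (ω : C(ℝ≥0, ℝ) × C(ℝ≥0, ℝ)) ↦ ω.1 t) (wienerLawC.prod wienerLawC) := by
  refine ⟨fun I ↦ ⟨?_, ?_⟩⟩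
  · exact (measurable_pi_lambda _ fun i ↦
      (measurable_coordProcess _).comp measurable_fst).aemeasurable
  · have h := (isPreBrownianReal_coordProcess.hasLaw I).map_eq
    have hm : Measurable fun (p : C(ℝ≥0, ℝ)) ↦ I.restrict (coordProcess · p) :=
      measurable_pi_lambda _ fun i ↦ measurable_coordProcess _
    have : (fun (ω : C(ℝ≥0, ℝ) × C(ℝ≥0, ℝ)) ↦ I.restrict (fun t ↦ ω.1 t)) =
        (fun p ↦ I.restrict (coordProcess · p)) ∘ Prod.fst := rfl
    rw [this, ← Measure.map_map hm measurable_fst, Measure.map_fst_prod, measure_univ, one_smul]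
    exact h

/-- The second coordinate path process is pre-Brownian under the product Wiener law. [folklore] -/
theorem isPreBrownianReal_snd :
    IsPreBrownianReal (fun t (ω : C(ℝ≥0, ℝ) × C(ℝ≥0, ℝ)) ↦ ω.2 t) (wienerLawC.prod wienerLawC) := by
  refine ⟨fun I ↦ ⟨?_, ?_⟩⟩
  · exact (measurable_pi_lambda _ fun i ↦
      (measurable_coordProcess _).comp measurable_snd).aemeasurable
  · have h := (isPreBrownianReal_coordProcess.hasLaw I).map_eq
    have hm : Measurable fun (p : C(ℝ≥0, ℝ)) ↦ I.restrict (coordProcess · p) :=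
      measurable_pi_lambda _ fun i ↦ measurable_coordProcess _
    have : (fun (ω : C(ℝ≥0, ℝ) × C(ℝ≥0, ℝ)) ↦ I.restrict (fun t ↦ ω.2 t)) =
        (fun p ↦ I.restrict (coordProcess · p)) ∘ Prod.snd := rfl
    rw [this, ← Measure.map_map hm measurable_snd, Measure.map_snd_prod, measure_univ, one_smul]
    exact h

/-- **The two coordinate paths are independent** under the product Wiener law (as raw-path
valued random variables). [folklore] -/
theorem indepFun_fst_snd_path :
    IndepFun (fun (ω : C(ℝ≥0, ℝ) × C(ℝ≥0, ℝ)) (t : ℝ≥0) ↦ ω.1 t) (fun ω (t : ℝ≥0) ↦ ω.2 t)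
      (wienerLawC.prod wienerLawC) :=
  indepFun_prod (X := fun (p : C(ℝ≥0, ℝ)) (t : ℝ≥0) ↦ p t) (Y := fun (p : C(ℝ≥0, ℝ)) (t : ℝ≥0) ↦ p t)
    (measurable_pi_lambda _ fun t ↦ measurable_coordProcess t)
    (measurable_pi_lambda _ fun t ↦ measurable_coordProcess t)

/-- Finite-dimensional marginals of the two coordinate processes are independent. [folklore] -/
theorem indepFun_restrict_fst_snd (I J : Finset ℝ≥0) :
    IndepFun (fun (ω : C(ℝ≥0, ℝ) × C(ℝ≥0, ℝ)) ↦ I.restrict (fun t ↦ ω.1 t))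
      (fun ω ↦ J.restrict (fun t ↦ ω.2 t)) (wienerLawC.prod wienerLawC) :=
  indepFun_fst_snd_path.comp (Finset.measurable_restrict I) (Finset.measurable_restrict J)

/-! ### Joint Gaussianity of the two coordinate processes -/

/-- **The two coordinate processes are jointly Gaussian**: the process on `ℝ≥0 ⊕ ℝ≥0` which is
`p¹` on the left copy and `p²` on the right copy is Gaussian under the product Wiener law
(independent Gaussian marginals are jointly Gaussian, Mathlib `IndepFun.hasGaussianLaw`).
[folklore] -/
theorem isGaussianProcess_sumElim_coord :
    IsGaussianProcess (Sum.elim (fun t (ω : C(ℝ≥0, ℝ) × C(ℝ≥0, ℝ)) ↦ ω.1 t) (fun t ω ↦ ω.2 t))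
      (wienerLawC.prod wienerLawC) := by
  refine ⟨fun I ↦ ?_⟩
  have h1 := isPreBrownianReal_fst.isGaussianProcess.hasGaussianLaw I.toLeft
  have h2 := isPreBrownianReal_snd.isGaussianProcess.hasGaussianLaw I.toRight
  have hpair := IndepFun.hasGaussianLaw h1 h2 (indepFun_restrict_fst_snd I.toLeft I.toRight)
  -- rearranging `((p¹ on I.toLeft), (p² on I.toRight))` into one vector indexed by `I` is linear
  let Llin : ((I.toLeft → ℝ) × (I.toRight → ℝ)) →ₗ[ℝ] (I → ℝ) :=
    { toFun := fun x i ↦ match i with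
        | ⟨Sum.inl s, h⟩ => x.1 ⟨s, Finset.mem_toLeft.2 h⟩
        | ⟨Sum.inr t, h⟩ => x.2 ⟨t, Finset.mem_toRight.2 h⟩
      map_add' := fun x y ↦ by
        funext i
        obtain ⟨i, hi⟩ := i
        cases i <;> rfl
      map_smul' := fun c x ↦ by
        funext i
        obtain ⟨i, hi⟩ := i
        cases i <;> rfl }
  set L : ((I.toLeft → ℝ) × (I.toRight → ℝ)) →L[ℝ] (I → ℝ) :=
    LinearMap.toContinuousLinearMap Llin with hL
  have heq : (fun (ω : C(ℝ≥0, ℝ) × C(ℝ≥0, ℝ)) ↦ I.restrict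
      (Sum.elim (fun t (ω : C(ℝ≥0, ℝ) × C(ℝ≥0, ℝ)) ↦ ω.1 t) (fun t ω ↦ ω.2 t) · ω)) =
      L ∘ fun ω ↦ (I.toLeft.restrict (fun t ↦ ω.1 t), I.toRight.restrict (fun t ↦ ω.2 t)) := by
    funext ω
    funext i
    obtain ⟨i, hi⟩ := i
    cases i <;> simp [hL, Llin]
  rw [heq]
  exact hpair.map L

/-! ### The rotated processes `U`, `V` -/

/-- `U` is measurable at each time. [folklore] -/
theorem measurable_rotU (t : ℝ≥0) :
    Measurable fun (ω : C(ℝ≥0, ℝ) × C(ℝ≥0, ℝ)) ↦ (ω.1 (2 * t) + ω.2 (2 * t)) / 2 :=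
  (((measurable_coordProcess _).comp measurable_fst).add
    ((measurable_coordProcess _).comp measurable_snd)).div_const 2

/-- `V` is measurable at each time. [folklore] -/
theorem measurable_rotV (t : ℝ≥0) :
    Measurable fun (ω : C(ℝ≥0, ℝ) × C(ℝ≥0, ℝ)) ↦ (ω.1 (2 * t) - ω.2 (2 * t)) / 2 :=
  (((measurable_coordProcess _).comp measurable_fst).sub
    ((measurable_coordProcess _).comp measurable_snd)).div_const 2

/-- **`U` and `V` are jointly Gaussian** (linear combinations of a jointly Gaussian pair).
[folklore] -/
theorem isGaussianProcess_sumElim_rot :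
    IsGaussianProcess (Sum.elim (fun t (ω : C(ℝ≥0, ℝ) × C(ℝ≥0, ℝ)) ↦ (ω.1 (2 * t) + ω.2 (2 * t)) / 2)
      (fun t ω ↦ (ω.1 (2 * t) - ω.2 (2 * t)) / 2)) (wienerLawC.prod wienerLawC) := by
  refine isGaussianProcess_sumElim_coord.of_isGaussianProcess fun i ↦ ?_
  rcases i with t | t
  · refine ⟨{Sum.inl (2 * t), Sum.inr (2 * t)},
      LinearMap.toContinuousLinearMap
        { toFun := fun x ↦ (x ⟨Sum.inl (2 * t), by simp⟩ + x ⟨Sum.inr (2 * t), by simp⟩) / 2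
          map_add' := fun x y ↦ by simp only [Pi.add_apply]; ring
          map_smul' := fun c x ↦ by
            simp only [Pi.smul_apply, smul_eq_mul, RingHom.id_apply]; ring }, fun ω ↦ ?_⟩
    rfl
  · refine ⟨{Sum.inl (2 * t), Sum.inr (2 * t)},
      LinearMap.toContinuousLinearMap
        { toFun := fun x ↦ (x ⟨Sum.inl (2 * t), by simp⟩ - x ⟨Sum.inr (2 * t), by simp⟩) / 2
          map_add' := fun x y ↦ by simp only [Pi.add_apply]; ring
          map_smul' := fun c x ↦ by
            simp only [Pi.smul_apply, smul_eq_mul, RingHom.id_apply]; ring }, fun ω ↦ ?_⟩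
    rfl

/-- Evaluations of the first coordinate process are square integrable. [folklore] -/
theorem memLp_two_fst (t : ℝ≥0) :
    MemLp (fun (ω : C(ℝ≥0, ℝ) × C(ℝ≥0, ℝ)) ↦ ω.1 t) 2 (wienerLawC.prod wienerLawC) :=
  (isPreBrownianReal_fst.isGaussianProcess.hasGaussianLaw_eval t).memLp_two

/-- Evaluations of the second coordinate process are square integrable. [folklore] -/
theorem memLp_two_snd (t : ℝ≥0) :
    MemLp (fun (ω : C(ℝ≥0, ℝ) × C(ℝ≥0, ℝ)) ↦ ω.2 t) 2 (wienerLawC.prod wienerLawC) :=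
  (isPreBrownianReal_snd.isGaussianProcess.hasGaussianLaw_eval t).memLp_two

/-- Cross covariances of the two coordinate processes vanish (independence). [folklore] -/
theorem covariance_fst_snd (s t : ℝ≥0) :
    cov[fun (ω : C(ℝ≥0, ℝ) × C(ℝ≥0, ℝ)) ↦ ω.1 s, fun ω ↦ ω.2 t; wienerLawC.prod wienerLawC] = 0 := by
  have hind : IndepFun (fun (ω : C(ℝ≥0, ℝ) × C(ℝ≥0, ℝ)) ↦ ω.1 s) (fun ω ↦ ω.2 t)
      (wienerLawC.prod wienerLawC) :=
    indepFun_prod (X := fun (p : C(ℝ≥0, ℝ)) ↦ p s) (Y := fun (p : C(ℝ≥0, ℝ)) ↦ p t)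
      (measurable_coordProcess s) (measurable_coordProcess t)
  exact hind.covariance_eq_zero (memLp_two_fst s) (memLp_two_snd t)

/-- Covariances of one coordinate process: `Cov(p(s), p(t)) = s ∧ t`. [folklore] -/
theorem covariance_fst_fst (s t : ℝ≥0) :
    cov[fun (ω : C(ℝ≥0, ℝ) × C(ℝ≥0, ℝ)) ↦ ω.1 s, fun ω ↦ ω.1 t; wienerLawC.prod wienerLawC] =
      min s t :=
  isPreBrownianReal_fst.covariance_fun_eval s t

/-- Covariances of the second coordinate process. [folklore] -/
theorem covariance_snd_snd (s t : ℝ≥0) :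
    cov[fun (ω : C(ℝ≥0, ℝ) × C(ℝ≥0, ℝ)) ↦ ω.2 s, fun ω ↦ ω.2 t; wienerLawC.prod wienerLawC] =
      min s t :=
  isPreBrownianReal_snd.covariance_fun_eval s t

omit [MeasurableSpace C(ℝ≥0, ℝ)] [BorelSpace C(ℝ≥0, ℝ)] in
/-- **Covariance algebra of the rotation**: for square integrable `A, B, C, D` with
`Cov(A, D) = Cov(B, C) = 0` and signs `σ, τ`,
`Cov((A + σB)/2, (C + τD)/2) = (Cov(A, C) + στ Cov(B, D))/4`. [folklore] -/
theorem covariance_rot {Ω : Type*} [MeasurableSpace Ω] {μ : Measure Ω} [IsProbabilityMeasure μ]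
    {A B C D : Ω → ℝ} (hA : MemLp A 2 μ) (hB : MemLp B 2 μ) (hC : MemLp C 2 μ) (hD : MemLp D 2 μ)
    (hAD : cov[A, D; μ] = 0) (hBC : cov[B, C; μ] = 0) (σ τ : ℝ) :
    cov[fun ω ↦ (A ω + σ * B ω) / 2, fun ω ↦ (C ω + τ * D ω) / 2; μ] =
      (cov[A, C; μ] + σ * τ * cov[B, D; μ]) / 4 := by
  have hσB : MemLp (fun ω ↦ σ * B ω) 2 μ := hB.const_mul σ
  have hτD : MemLp (fun ω ↦ τ * D ω) 2 μ := hD.const_mul τ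
  have h1 : (fun ω ↦ (A ω + σ * B ω) / 2) = fun ω ↦ (1 / 2) * (A + fun ω ↦ σ * B ω) ω := by
    funext ω; simp only [Pi.add_apply]; ring
  have h2 : (fun ω ↦ (C ω + τ * D ω) / 2) = fun ω ↦ (1 / 2) * (C + fun ω ↦ τ * D ω) ω := by
    funext ω; simp only [Pi.add_apply]; ring
  have hBD : cov[fun ω ↦ σ * B ω, fun ω ↦ τ * D ω; μ] = σ * τ * cov[B, D; μ] := by
    rw [covariance_const_mul_left, covariance_const_mul_right]; ring
  have hAD' : cov[A, fun ω ↦ τ * D ω; μ] = 0 := by rw [covariance_const_mul_right, hAD, mul_zero]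
  have hBC' : cov[fun ω ↦ σ * B ω, C; μ] = 0 := by rw [covariance_const_mul_left, hBC, mul_zero]
  rw [h1, h2, covariance_const_mul_left, covariance_const_mul_right,
    covariance_add_left hA hσB (hC.add hτD), covariance_add_right hA hC hτD,
    covariance_add_right hσB hC hτD, hBD, hAD', hBC']
  ring

omit [MeasurableSpace C(ℝ≥0, ℝ)] [BorelSpace C(ℝ≥0, ℝ)] in
/-- `min (2s) (2t) = 2 min s t`, read in `ℝ`. [folklore] -/
theorem coe_min_two_mul (s t : ℝ≥0) : (((min (2 * s) (2 * t) : ℝ≥0)) : ℝ) = 2 * ((min s t : ℝ≥0) : ℝ) := by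
  push_cast
  rcases le_total (s : ℝ) t with h | h
  · rw [min_eq_left h, min_eq_left (by linarith)]
  · rw [min_eq_right h, min_eq_right (by linarith)]

/-- `Cov(U_s, U_t) = s ∧ t`. [folklore] -/
theorem covariance_rotU (s t : ℝ≥0) :
    cov[fun (ω : C(ℝ≥0, ℝ) × C(ℝ≥0, ℝ)) ↦ (ω.1 (2 * s) + ω.2 (2 * s)) / 2,
      fun ω ↦ (ω.1 (2 * t) + ω.2 (2 * t)) / 2; wienerLawC.prod wienerLawC] = ((min s t : ℝ≥0) : ℝ) := by
  have h := covariance_rot (μ := wienerLawC.prod wienerLawC) (memLp_two_fst (2 * s))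
    (memLp_two_snd (2 * s)) (memLp_two_fst (2 * t)) (memLp_two_snd (2 * t))
    (covariance_fst_snd (2 * s) (2 * t)) (by rw [covariance_comm]; exact covariance_fst_snd _ _) 1 1
  simp only [one_mul] at h
  rw [h, covariance_fst_fst, covariance_snd_snd, coe_min_two_mul]
  ring

/-- `Cov(V_s, V_t) = s ∧ t`. [folklore] -/
theorem covariance_rotV (s t : ℝ≥0) :
    cov[fun (ω : C(ℝ≥0, ℝ) × C(ℝ≥0, ℝ)) ↦ (ω.1 (2 * s) - ω.2 (2 * s)) / 2,
      fun ω ↦ (ω.1 (2 * t) - ω.2 (2 * t)) / 2; wienerLawC.prod wienerLawC] = ((min s t : ℝ≥0) : ℝ) := by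
  have h := covariance_rot (μ := wienerLawC.prod wienerLawC) (memLp_two_fst (2 * s))
    (memLp_two_snd (2 * s)) (memLp_two_fst (2 * t)) (memLp_two_snd (2 * t))
    (covariance_fst_snd (2 * s) (2 * t)) (by rw [covariance_comm]; exact covariance_fst_snd _ _)
    (-1) (-1)
  have h1 : (fun (ω : C(ℝ≥0, ℝ) × C(ℝ≥0, ℝ)) ↦ (ω.1 (2 * s) - ω.2 (2 * s)) / 2) =
      fun ω ↦ (ω.1 (2 * s) + (-1) * ω.2 (2 * s)) / 2 := by funext ω; ring
  have h2 : (fun (ω : C(ℝ≥0, ℝ) × C(ℝ≥0, ℝ)) ↦ (ω.1 (2 * t) - ω.2 (2 * t)) / 2) =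
      fun ω ↦ (ω.1 (2 * t) + (-1) * ω.2 (2 * t)) / 2 := by funext ω; ring
  rw [h1, h2, h, covariance_fst_fst, covariance_snd_snd, coe_min_two_mul]
  ring

/-- `Cov(U_s, V_t) = 0`. [folklore] -/
theorem covariance_rotU_rotV (s t : ℝ≥0) :
    cov[fun (ω : C(ℝ≥0, ℝ) × C(ℝ≥0, ℝ)) ↦ (ω.1 (2 * s) + ω.2 (2 * s)) / 2,
      fun ω ↦ (ω.1 (2 * t) - ω.2 (2 * t)) / 2; wienerLawC.prod wienerLawC] = 0 := by
  have h := covariance_rot (μ := wienerLawC.prod wienerLawC) (memLp_two_fst (2 * s))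
    (memLp_two_snd (2 * s)) (memLp_two_fst (2 * t)) (memLp_two_snd (2 * t))
    (covariance_fst_snd (2 * s) (2 * t)) (by rw [covariance_comm]; exact covariance_fst_snd _ _)
    1 (-1)
  have h2 : (fun (ω : C(ℝ≥0, ℝ) × C(ℝ≥0, ℝ)) ↦ (ω.1 (2 * t) - ω.2 (2 * t)) / 2) =
      fun ω ↦ (ω.1 (2 * t) + (-1) * ω.2 (2 * t)) / 2 := by funext ω; ring
  simp only [one_mul] at h
  rw [h2, h, covariance_fst_fst, covariance_snd_snd, coe_min_two_mul]
  ring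

/-- `U` is centred. [folklore] -/
theorem integral_rotU (t : ℝ≥0) :
    ∫ ω, (ω.1 (2 * t) + ω.2 (2 * t)) / 2 ∂(wienerLawC.prod wienerLawC : Measure (C(ℝ≥0, ℝ) × C(ℝ≥0, ℝ))) = 0 := by
  rw [integral_div, integral_add ((memLp_two_fst _).integrable one_le_two)
    ((memLp_two_snd _).integrable one_le_two)]
  have h1 := isPreBrownianReal_fst.integral_eval (2 * t)
  have h2 := isPreBrownianReal_snd.integral_eval (2 * t)
  rw [h1, h2]
  norm_num

/-- `V` is centred. [folklore] -/
theorem integral_rotV (t : ℝ≥0) :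
    ∫ ω, (ω.1 (2 * t) - ω.2 (2 * t)) / 2 ∂(wienerLawC.prod wienerLawC : Measure (C(ℝ≥0, ℝ) × C(ℝ≥0, ℝ))) = 0 := by
  rw [integral_div, integral_sub ((memLp_two_fst _).integrable one_le_two)
    ((memLp_two_snd _).integrable one_le_two)]
  have h1 := isPreBrownianReal_fst.integral_eval (2 * t)
  have h2 := isPreBrownianReal_snd.integral_eval (2 * t)
  rw [h1, h2]
  norm_num

/-- **`U(t) = (p¹(2t) + p²(2t))/2` is a pre-Brownian motion** under the product Wiener law
(centred Gaussian process with covariance `s ∧ t`). Le Gall (2016), Exercise 2.26 (rotations);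
Prop. 2.5 (scaling). [cite: Legall2016, Prop. 2.5] -/
theorem isPreBrownianReal_rotU :
    IsPreBrownianReal (fun t (ω : C(ℝ≥0, ℝ) × C(ℝ≥0, ℝ)) ↦ (ω.1 (2 * t) + ω.2 (2 * t)) / 2)
      (wienerLawC.prod wienerLawC) := by
  have hG : IsGaussianProcess (fun t (ω : C(ℝ≥0, ℝ) × C(ℝ≥0, ℝ)) ↦ (ω.1 (2 * t) + ω.2 (2 * t)) / 2)
      (wienerLawC.prod wienerLawC) := by
    have := isGaussianProcess_sumElim_rot.comp_right Sum.inl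
    rwa [Sum.elim_comp_inl] at this
  refine hG.isPreBrownianReal_of_covariance (fun t ↦ integral_rotU t) (fun s t hst ↦ ?_)
  rw [covariance_rotU, min_eq_left hst]

/-- **`V(t) = (p¹(2t) - p²(2t))/2` is a pre-Brownian motion** under the product Wiener law.
[cite: Legall2016, Prop. 2.5] -/
theorem isPreBrownianReal_rotV :
    IsPreBrownianReal (fun t (ω : C(ℝ≥0, ℝ) × C(ℝ≥0, ℝ)) ↦ (ω.1 (2 * t) - ω.2 (2 * t)) / 2)
      (wienerLawC.prod wienerLawC) := by
  have hG : IsGaussianProcess (fun t (ω : C(ℝ≥0, ℝ) × C(ℝ≥0, ℝ)) ↦ (ω.1 (2 * t) - ω.2 (2 * t)) / 2)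
      (wienerLawC.prod wienerLawC) := by
    have := isGaussianProcess_sumElim_rot.comp_right Sum.inr
    rwa [Sum.elim_comp_inr] at this
  refine hG.isPreBrownianReal_of_covariance (fun t ↦ integral_rotV t) (fun s t hst ↦ ?_)
  rw [covariance_rotV, min_eq_left hst]

/-- **`U` and `V` are independent** (jointly Gaussian with zero cross covariance), as raw-path
valued random variables. [cite: Legall2016, Exercise 2.26] -/
theorem indepFun_rotU_rotV :
    IndepFun (fun (ω : C(ℝ≥0, ℝ) × C(ℝ≥0, ℝ)) (s : ℝ≥0) ↦ (ω.1 (2 * s) + ω.2 (2 * s)) / 2)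
      (fun ω (t : ℝ≥0) ↦ (ω.1 (2 * t) - ω.2 (2 * t)) / 2) (wienerLawC.prod wienerLawC) :=
  isGaussianProcess_sumElim_rot.indepFun_of_covariance_eq_zero
    (fun s ↦ (measurable_rotU s).aemeasurable) (fun t ↦ (measurable_rotV t).aemeasurable)
    fun s t ↦ covariance_rotU_rotV s t

/-! ### The rotated pair as a pair of Wiener paths -/

omit [MeasurableSpace C(ℝ≥0, ℝ)] [BorelSpace C(ℝ≥0, ℝ)] in
/-- Paths of `U` are continuous. [folklore] -/
theorem continuous_rotU (ω : C(ℝ≥0, ℝ) × C(ℝ≥0, ℝ)) :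
    Continuous fun t : ℝ≥0 ↦ (ω.1 (2 * t) + ω.2 (2 * t)) / 2 :=
  ((ω.1.continuous.comp (continuous_const.mul continuous_id)).add
    (ω.2.continuous.comp (continuous_const.mul continuous_id))).div_const 2

omit [MeasurableSpace C(ℝ≥0, ℝ)] [BorelSpace C(ℝ≥0, ℝ)] in
/-- Paths of `V` are continuous. [folklore] -/
theorem continuous_rotV (ω : C(ℝ≥0, ℝ) × C(ℝ≥0, ℝ)) :
    Continuous fun t : ℝ≥0 ↦ (ω.1 (2 * t) - ω.2 (2 * t)) / 2 :=
  ((ω.1.continuous.comp (continuous_const.mul continuous_id)).sub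
    (ω.2.continuous.comp (continuous_const.mul continuous_id))).div_const 2

/-- **The path law of `U` is the Wiener law.** [cite: Legall2016, Prop. 2.5] -/
theorem map_toPathC_rotU :
    (wienerLawC.prod wienerLawC).map
      (toPathC (fun t (ω : C(ℝ≥0, ℝ) × C(ℝ≥0, ℝ)) ↦ (ω.1 (2 * t) + ω.2 (2 * t)) / 2) continuous_rotU) =
      wienerLawC := by
  have hid : IdentDistrib (fun (ω : C(ℝ≥0, ℝ) × C(ℝ≥0, ℝ)) (t : ℝ≥0) ↦ (ω.1 (2 * t) + ω.2 (2 * t)) / 2)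
      (fun ω t ↦ Process.brownian t ω) (wienerLawC.prod wienerLawC) Process.preWienerMeasure :=
    ⟨(measurable_pi_lambda _ measurable_rotU).aemeasurable,
      (measurable_pi_lambda _ Process.measurable_brownian).aemeasurable,
      isPreBrownianReal_rotU.map_path_eq isPreBrownianReal_brownian measurable_rotU
        Process.measurable_brownian⟩
  exact (identDistrib_toPathC continuous_rotU Process.continuous_brownian measurable_rotU
    Process.measurable_brownian hid).map_eq

/-- **The path law of `V` is the Wiener law.** [cite: Legall2016, Prop. 2.5] -/
theorem map_toPathC_rotV :
    (wienerLawC.prod wienerLawC).map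
      (toPathC (fun t (ω : C(ℝ≥0, ℝ) × C(ℝ≥0, ℝ)) ↦ (ω.1 (2 * t) - ω.2 (2 * t)) / 2) continuous_rotV) =
      wienerLawC := by
  have hid : IdentDistrib (fun (ω : C(ℝ≥0, ℝ) × C(ℝ≥0, ℝ)) (t : ℝ≥0) ↦ (ω.1 (2 * t) - ω.2 (2 * t)) / 2)
      (fun ω t ↦ Process.brownian t ω) (wienerLawC.prod wienerLawC) Process.preWienerMeasure :=
    ⟨(measurable_pi_lambda _ measurable_rotV).aemeasurable,
      (measurable_pi_lambda _ Process.measurable_brownian).aemeasurable,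
      isPreBrownianReal_rotV.map_path_eq isPreBrownianReal_brownian measurable_rotV
        Process.measurable_brownian⟩
  exact (identDistrib_toPathC continuous_rotV Process.continuous_brownian measurable_rotV
    Process.measurable_brownian hid).map_eq

/-- **The path lifts of `U` and `V` are independent.** [cite: Legall2016, Exercise 2.26] -/
theorem indepFun_toPathC_rotU_rotV :
    IndepFun (toPathC (fun t (ω : C(ℝ≥0, ℝ) × C(ℝ≥0, ℝ)) ↦ (ω.1 (2 * t) + ω.2 (2 * t)) / 2) continuous_rotU)
      (toPathC (fun t (ω : C(ℝ≥0, ℝ) × C(ℝ≥0, ℝ)) ↦ (ω.1 (2 * t) - ω.2 (2 * t)) / 2) continuous_rotV)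
      (wienerLawC.prod wienerLawC) := by
  have h := indepFun_rotU_rotV
  rw [IndepFun_iff_Indep] at h ⊢
  rwa [comap_toPathC_eq, comap_toPathC_eq]

/-- **Rotation invariance of the planar Wiener law (45° rotation with time doubling).** Under
`wienerLawC ⊗ wienerLawC` the pair of paths `(U, V) = (t ↦ (p¹(2t) + p²(2t))/2,
t ↦ (p¹(2t) - p²(2t))/2)` has law `wienerLawC ⊗ wienerLawC`: "`t ↦ W(2t)` is a standard
planar Brownian motion" for `W = ((p¹ + p²)/2, (p¹ - p²)/2)`, the normalisation of Lawler
(1996), Lemma 3.1. [cite: Legall2016, Exercise 2.26] -/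
theorem map_rotate_eq_prod_wienerLawC :
    (wienerLawC.prod wienerLawC).map (fun ω : C(ℝ≥0, ℝ) × C(ℝ≥0, ℝ) ↦
      (toPathC (fun t (ω : C(ℝ≥0, ℝ) × C(ℝ≥0, ℝ)) ↦ (ω.1 (2 * t) + ω.2 (2 * t)) / 2) continuous_rotU ω,
       toPathC (fun t (ω : C(ℝ≥0, ℝ) × C(ℝ≥0, ℝ)) ↦ (ω.1 (2 * t) - ω.2 (2 * t)) / 2) continuous_rotV ω)) =
      wienerLawC.prod wienerLawC := by
  have hU := measurable_toPathC continuous_rotU measurable_rotU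
  have hV := measurable_toPathC continuous_rotV measurable_rotV
  rw [(indepFun_iff_map_prod_eq_prod_map_map hU.aemeasurable hV.aemeasurable).1
    indepFun_toPathC_rotU_rotV, map_toPathC_rotU, map_toPathC_rotV]

/-- **The rotation is measure preserving** on `(C([0,∞), ℝ)², wienerLawC ⊗ wienerLawC)`.
[cite: Legall2016, Exercise 2.26] -/
theorem measurePreserving_rotate :
    MeasurePreserving (fun ω : C(ℝ≥0, ℝ) × C(ℝ≥0, ℝ) ↦
      (toPathC (fun t (ω : C(ℝ≥0, ℝ) × C(ℝ≥0, ℝ)) ↦ (ω.1 (2 * t) + ω.2 (2 * t)) / 2) continuous_rotU ω,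
       toPathC (fun t (ω : C(ℝ≥0, ℝ) × C(ℝ≥0, ℝ)) ↦ (ω.1 (2 * t) - ω.2 (2 * t)) / 2) continuous_rotV ω))
      (wienerLawC.prod wienerLawC) (wienerLawC.prod wienerLawC) :=
  ⟨(measurable_toPathC continuous_rotU measurable_rotU).prodMk
    (measurable_toPathC continuous_rotV measurable_rotV), map_rotate_eq_prod_wienerLawC⟩

end Rotation

end Literature.Probability.RandomPlanarGeometry
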